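import Mathlib
import Literature.NumberTheory.LFunctions.Zhang2022.Section13MeanSquareTools
import Literature.NumberTheory.LFunctions.Zhang2022.TypedSection16ALeaves
import HarnessLib

/-!
# Zhang (2022) §13 p. 75, (13.11) «𝓔 = o(𝔓)»: parameter bookkeeping for the loss-free mean squares —
# `2t₀ ≤ T²`, `T⁷ ≤ P^{0.002}`, the lengths of `B`, `N·B`, `(E₁-poly)·B`, `N·N` are `≤ P`, the
# sharpened support `b(n) = 0` for `n ≥ PT⁻⁷`, and `B`, `N`, `K`, the `E₁`-polynomial as polynomials in `ψ`

Topic `Literature/NumberTheory/LFunctions/Zhang2022` (Landau–Siegel audit tree; verdict-neutral).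
Y. Zhang, *Discrete mean estimates and the Landau–Siegel zero*, arXiv:2211.02515v1 (2022)
[Zhang2022LandauSiegel], §13 p. 75 (tex L3806–3817): "Combining (2.34), Cauchy's inequality,
Proposition 7.1, Lemma 5.9, 6.1 and 3.3, we can verify that `𝓔 = o(𝔓)` (13.11)" — NOT carried out in
print (plan/GAP-LEDGER G-L3t6-3; lane ZHANG-L WP14, leaf `Skeleton.Eq1311Rel c′ c₀`; companion of
`Section13MeanSquareTools`). **An unrefereed manuscript under adjudication; nothing here asserts its
Theorems 1–2.**

Every factor of `E₁*(ρ,ψ)|B(ρ,ψ)|` other than the `L`-values is a Dirichlet polynomial in `ψ` of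
length `≤ P` — `B` has length `< PT⁻⁷` ((15.2) sharpened: `b(n) = 0` for `n ≥ PT⁻⁷`,
`bcoef_eq_zero_of_le_T7`), `N` has length `2T²`, the `E₁`-polynomial `Σ_{n<T³}ψ(n)n^{−w}` length `T³`,
`K` length `2P₄ ≤ P` — and so are the products `N·B`, `(E₁-poly)·B`, `N·N`. Hence the FIRST
assertion of Lemma 3.3 (`Section13MeanSquareTools.meanSq_floorP_le`, scale `𝔓`, no large-sieve
loss) bounds their mean squares over any finite `T ⊆ Ψ`, uniformly on `|Re s − ½| ≤ 2α` and in the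
purely imaginary shifts `β` (`β_j` of (2.13), `β_j + iv` of `E₁`):

(the mean squares themselves are in the companion `Section13MeanSquaresShort`). This file:

* `eventually_two_t0_le_Tsq` (`2t₀ ≤ T²`, so `2P₄ ≤ P`), `sizes_of_four_le_ell` (`T ≥ 5`,
  `T⁷ ≤ P^{0.002}` for `𝓛 ≥ 4`), `lengths_of_four_le_ell` (`2 ≤ ⌈2T²⌉, ⌈T³⌉`; `log⌈2T²⌉ ≤ 3𝓛²`,
  `log⌈T³⌉ ≤ 4𝓛²`, `log⌊P⌋ ≤ 𝓛⁹`; the products `(2T²)(PT⁻⁷)`, `T³·PT⁻⁷`, `(2T²)²` and the singles are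
  lengths `≤ ⌊P⌋`), `ceil_sub_one_mul_le_floor`;
* `bcoef_eq_zero_of_le_T7` — **(15.2) sharpened**: `b(n) = 0` for `n ≥ PT⁻⁷` (`P^{1/2}max(P₂,P₃) ≤ PT⁻⁷`);
* `Bpoly_eq_dirPoly`, `Nchar_shift_eq_dirPoly`, `Kchar_shift_eq_dirPoly`, `E1poly_shift_eq_dirPoly` —
  `B(s,ψ)`, `N(s+β,ψ)`, `K(s+β,ψ)`, `Σ_{n<T³}ψ(n)n^{−(s+β)}` as truncated polynomials `Σ c(n)ψ(n)n^{−s}`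
  with the shift `n^{−β}` inside the coefficients.

Theorem-only; no definitions, no new facts; Assumption (A) is not used.
WHAT THIS IS NOT: any claim about Theorems 1–2 of the manuscript or about Landau–Siegel zeros.

## References

* Y. Zhang, arXiv:2211.02515v1 (2022), §13 p. 75; §3 Lemma 3.3 p. 14; §6 Lemma 6.1 p. 30;
  §15 (15.1)–(15.2) p. 79. [cite: Zhang2022LandauSiegel, §13 (13.11) p.75]
-/

noncomputable section

open Complex Real Finset Filter

namespace Literature.NumberTheory.LFunctions.Zhang2022.Typed.Section13

open Skeleton MeanSquareMajorant Section7Eq75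

/-! ## A. The parameters for large `D` -/

/-- `𝓛 = log D → ∞`. [cite: Zhang2022LandauSiegel, §2 (2.1)] -/
theorem tendsto_ell_atTop : Tendsto (fun D : ℕ => ell D) atTop atTop :=
  Real.tendsto_log_atTop.comp tendsto_natCast_atTop_atTop

/-- **`2t₀ ≤ T²` for all large `D`** (`2𝓛⁵¹⁹ ≤ exp(2𝓛^{1.1})`, polynomial versus exponential), hence
`2P₄ = 2PT⁻²t₀ ≤ P`: the length of `K(s,ψ)` is at most `P`. [cite: Zhang2022LandauSiegel, §2 (2.8); §6 p.30] -/
theorem eventually_two_t0_le_Tsq : ∃ D₀ : ℕ, ∀ D : ℕ, D₀ ≤ D → 2 * t0 D ≤ bigT D ^ 2 := by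
  have h1 : ∀ᶠ L : ℝ in atTop, ‖L ^ 519‖ ≤ 1 / 2 * ‖Real.exp (2 * L)‖ :=
    (isLittleO_pow_exp_pos_mul_atTop 519 (by norm_num : (0 : ℝ) < 2)).bound (by norm_num)
  have h2 : ∀ᶠ L : ℝ in atTop, 1 ≤ L := eventually_ge_atTop 1
  obtain ⟨D₀, h⟩ := Filter.eventually_atTop.mp (tendsto_ell_atTop.eventually (h1.and h2))
  refine ⟨D₀, fun D hD => ?_⟩
  obtain ⟨hA, hL1⟩ := h D hD
  have hL0 : 0 ≤ ell D := by linarith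
  rw [Real.norm_of_nonneg (pow_nonneg hL0 _), Real.norm_of_nonneg (Real.exp_pos _).le] at hA
  have hexp : Real.exp (2 * ell D) ≤ Real.exp (2 * ell D ^ (1.1 : ℝ)) := by
    refine Real.exp_le_exp.mpr (mul_le_mul_of_nonneg_left ?_ (by norm_num))
    calc ell D = ell D ^ (1 : ℝ) := (Real.rpow_one _).symm
      _ ≤ ell D ^ (1.1 : ℝ) := Real.rpow_le_rpow_of_exponent_le hL1 (by norm_num)
  have hT : bigT D ^ 2 = Real.exp (2 * ell D ^ (1.1 : ℝ)) := by
    rw [bigT, ← Real.exp_nat_mul]; norm_num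
  rw [t0, hT]
  linarith

/-- For `𝓛 ≥ 1`: `log T = 𝓛^{1.1} ≤ 𝓛²` and `𝓛 ≤ 𝓛^{1.1}`. [cite: Zhang2022LandauSiegel, §6 p.30] -/
theorem ell_rpow_bounds {D : ℕ} (hL : 1 ≤ ell D) :
    ell D ≤ ell D ^ (1.1 : ℝ) ∧ ell D ^ (1.1 : ℝ) ≤ ell D ^ 2 := by
  constructor
  · calc ell D = ell D ^ (1 : ℝ) := (Real.rpow_one _).symm
      _ ≤ ell D ^ (1.1 : ℝ) := Real.rpow_le_rpow_of_exponent_le hL (by norm_num)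
  · have := Real.rpow_le_rpow_of_exponent_le hL (show (1.1 : ℝ) ≤ 2 by norm_num)
    rwa [Real.rpow_two] at this

/-- For `𝓛 ≥ 4`: `T ≥ 5`, `T⁷ ≤ P^{0.002}` (`7𝓛^{1.1} ≤ 7𝓛² ≤ 0.002𝓛⁹`), `T⁷ ≤ P`, `2 ≤ ⌊P⌋`.
[cite: Zhang2022LandauSiegel, §2 (2.6); §6 p.30] -/
theorem sizes_of_four_le_ell {D : ℕ} (hL : 4 ≤ ell D) :
    5 ≤ bigT D ∧ bigT D ^ 7 ≤ bigP D ^ (0.002 : ℝ) ∧ bigT D ^ 7 ≤ bigP D ∧ 2 ≤ ⌊bigP D⌋₊ := by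
  have hL1 : 1 ≤ ell D := by linarith
  obtain ⟨h1, h2⟩ := ell_rpow_bounds hL1
  have hT5 : 5 ≤ bigT D := by
    rw [bigT]
    have h4 : (4 : ℝ) ≤ ell D ^ (1.1 : ℝ) := le_trans hL h1
    have := Real.add_one_le_exp (ell D ^ (1.1 : ℝ))
    linarith
  have h7 : (7 : ℝ) * ell D ^ (1.1 : ℝ) ≤ 0.002 * ell D ^ 9 := by
    have h27 : (64 : ℝ) ≤ ell D ^ 3 := by nlinarith
    have : ell D ^ 9 = ell D ^ 2 * (ell D ^ 3 * ell D ^ 3 * ell D) := by ring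
    have h3500 : 3500 * ell D ^ 2 ≤ ell D ^ 9 := by
      rw [this]
      have : (3500 : ℝ) ≤ ell D ^ 3 * ell D ^ 3 * ell D := by nlinarith
      nlinarith
    nlinarith
  have hT7 : bigT D ^ 7 ≤ bigP D ^ (0.002 : ℝ) := by
    rw [bigT, bigP, ← Real.exp_nat_mul, ← Real.exp_mul, Real.exp_le_exp]
    push_cast
    linarith
  have hP1 : 1 ≤ bigP D := Real.one_le_exp (by positivity)
  have hT7P : bigT D ^ 7 ≤ bigP D :=
    hT7.trans (by simpa using Real.rpow_le_rpow_of_exponent_le hP1 (show (0.002 : ℝ) ≤ 1 by norm_num))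
  refine ⟨hT5, hT7, hT7P, Nat.le_floor ?_⟩
  push_cast
  nlinarith [pow_le_pow_left₀ (by norm_num : (0 : ℝ) ≤ 5) hT5 7]

/-- `(⌈a⌉ − 1)(⌈b⌉ − 1) ≤ ⌊c⌋` when `0 ≤ a, b` and `ab ≤ c` (the length of a product of two truncated
polynomials). [cite: Zhang2022LandauSiegel, §3 Lemma 3.3 p.14] -/
theorem ceil_sub_one_mul_le_floor {a b c : ℝ} (ha : 0 ≤ a) (hb : 0 ≤ b) (h : a * b ≤ c) :
    (⌈a⌉₊ - 1) * (⌈b⌉₊ - 1) ≤ ⌊c⌋₊ := by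
  have h1 : ((⌈a⌉₊ - 1 : ℕ) : ℝ) ≤ a := cast_ceil_sub_one_le ha
  have h2 : ((⌈b⌉₊ - 1 : ℕ) : ℝ) ≤ b := cast_ceil_sub_one_le hb
  apply Nat.le_floor
  push_cast
  exact (mul_le_mul h1 h2 (Nat.cast_nonneg _) ha).trans h

/-- `⌈a⌉ − 1 ≤ ⌊c⌋` when `0 ≤ a ≤ c`. [cite: Zhang2022LandauSiegel, §3 Lemma 3.3 p.14] -/
theorem ceil_sub_one_le_floor {a c : ℝ} (ha : 0 ≤ a) (h : a ≤ c) : ⌈a⌉₊ - 1 ≤ ⌊c⌋₊ := by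
  have h1 : ((⌈a⌉₊ - 1 : ℕ) : ℝ) ≤ a := cast_ceil_sub_one_le ha
  exact Nat.le_floor (h1.trans h)

/-- The lengths for `𝓛 ≥ 4`: `2 ≤ ⌈2T²⌉, ⌈T³⌉`; `log⌈2T²⌉ ≤ 3𝓛²`, `log⌈T³⌉ ≤ 4𝓛²`, `log⌊P⌋ ≤ 𝓛⁹`;
and the products `(2T²)(PT⁻⁷)`, `T³·PT⁻⁷`, `(2T²)²` and the singles `2T²`, `T³`, `PT⁻⁷` are `≤ P`
(as lengths `≤ ⌊P⌋`). [cite: Zhang2022LandauSiegel, §3 Lemma 3.3 p.14; §6 p.30] -/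
theorem lengths_of_four_le_ell {D : ℕ} (hL : 4 ≤ ell D) :
    (2 ≤ ⌈2 * bigT D ^ 2⌉₊ ∧ 2 ≤ ⌈bigT D ^ 3⌉₊) ∧
    (Real.log (⌈2 * bigT D ^ 2⌉₊ : ℝ) ≤ 3 * ell D ^ 2 ∧ Real.log (⌈bigT D ^ 3⌉₊ : ℝ) ≤ 4 * ell D ^ 2 ∧
      Real.log (⌊bigP D⌋₊ : ℝ) ≤ ell D ^ 9) ∧
    ((⌈2 * bigT D ^ 2⌉₊ - 1) * (⌈bigP D / bigT D ^ 7⌉₊ - 1) ≤ ⌊bigP D⌋₊ ∧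
      (⌈bigT D ^ 3⌉₊ - 1) * (⌈bigP D / bigT D ^ 7⌉₊ - 1) ≤ ⌊bigP D⌋₊ ∧
      (⌈2 * bigT D ^ 2⌉₊ - 1) * (⌈2 * bigT D ^ 2⌉₊ - 1) ≤ ⌊bigP D⌋₊) ∧
    (⌈2 * bigT D ^ 2⌉₊ - 1 ≤ ⌊bigP D⌋₊ ∧ ⌈bigT D ^ 3⌉₊ - 1 ≤ ⌊bigP D⌋₊ ∧
      ⌈bigP D / bigT D ^ 7⌉₊ - 1 ≤ ⌊bigP D⌋₊) := by
  have hL1 : 1 ≤ ell D := by linarith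
  obtain ⟨hT5, -, hT7P, hP2⟩ := sizes_of_four_le_ell hL
  obtain ⟨h1, h2⟩ := ell_rpow_bounds hL1
  have hT0 : 0 < bigT D := by linarith
  have hP0 : 0 < bigP D := Real.exp_pos _
  have hT1 : 1 ≤ bigT D := by linarith
  have hlogT : Real.log (bigT D) = ell D ^ (1.1 : ℝ) := by rw [bigT, Real.log_exp]
  -- powers of `T`
  have hT2 : bigT D ^ 2 ≤ bigT D ^ 7 := pow_le_pow_right₀ hT1 (by norm_num)
  have hT3 : bigT D ^ 3 ≤ bigT D ^ 7 := pow_le_pow_right₀ hT1 (by norm_num)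
  have hT4 : bigT D ^ 4 ≤ bigT D ^ 7 := pow_le_pow_right₀ hT1 (by norm_num)
  have h25 : (25 : ℝ) ≤ bigT D ^ 2 := by nlinarith
  have h125 : (125 : ℝ) ≤ bigT D ^ 3 := by nlinarith
  -- ceilings versus `T³`, `T⁴`
  have hc1 : (⌈2 * bigT D ^ 2⌉₊ : ℝ) ≤ bigT D ^ 3 := by
    have := Nat.ceil_lt_add_one (show 0 ≤ 2 * bigT D ^ 2 by positivity)
    nlinarith
  have hc2 : (⌈bigT D ^ 3⌉₊ : ℝ) ≤ bigT D ^ 4 := by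
    have := Nat.ceil_lt_add_one (show 0 ≤ bigT D ^ 3 by positivity)
    nlinarith
  have hc1pos : (0 : ℝ) < ⌈2 * bigT D ^ 2⌉₊ := lt_of_lt_of_le (by positivity) (Nat.le_ceil _)
  have hc2pos : (0 : ℝ) < ⌈bigT D ^ 3⌉₊ := lt_of_lt_of_le (by positivity) (Nat.le_ceil _)
  refine ⟨⟨?_, ?_⟩, ⟨?_, ?_, ?_⟩, ⟨?_, ?_, ?_⟩, ⟨?_, ?_, ?_⟩⟩
  · exact Nat.lt_ceil.mpr (by push_cast; linarith)
  · exact Nat.lt_ceil.mpr (by push_cast; linarith)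
  · calc Real.log (⌈2 * bigT D ^ 2⌉₊ : ℝ) ≤ Real.log (bigT D ^ 3) := Real.log_le_log hc1pos hc1
      _ = 3 * ell D ^ (1.1 : ℝ) := by rw [Real.log_pow, hlogT]; push_cast; ring
      _ ≤ 3 * ell D ^ 2 := by linarith
  · calc Real.log (⌈bigT D ^ 3⌉₊ : ℝ) ≤ Real.log (bigT D ^ 4) := Real.log_le_log hc2pos hc2
      _ = 4 * ell D ^ (1.1 : ℝ) := by rw [Real.log_pow, hlogT]; push_cast; ring
      _ ≤ 4 * ell D ^ 2 := by linarith
  · have hfl : (0 : ℝ) < ⌊bigP D⌋₊ := by exact_mod_cast (show 0 < ⌊bigP D⌋₊ by omega)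
    calc Real.log (⌊bigP D⌋₊ : ℝ) ≤ Real.log (bigP D) := Real.log_le_log hfl (Nat.floor_le hP0.le)
      _ = ell D ^ 9 := by rw [bigP, Real.log_exp]
  · refine ceil_sub_one_mul_le_floor (by positivity) (by positivity) ?_
    rw [show 2 * bigT D ^ 2 * (bigP D / bigT D ^ 7) = bigP D * (2 * bigT D ^ 2 / bigT D ^ 7) by ring]
    refine mul_le_of_le_one_right hP0.le ((div_le_one (by positivity)).mpr ?_)
    nlinarith
  · refine ceil_sub_one_mul_le_floor (by positivity) (by positivity) ?_
    rw [show bigT D ^ 3 * (bigP D / bigT D ^ 7) = bigP D * (bigT D ^ 3 / bigT D ^ 7) by ring]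
    exact mul_le_of_le_one_right hP0.le ((div_le_one (by positivity)).mpr hT3)
  · refine ceil_sub_one_mul_le_floor (by positivity) (by positivity) ?_
    nlinarith
  · refine ceil_sub_one_le_floor (by positivity) ?_
    nlinarith
  · exact ceil_sub_one_le_floor (by positivity) (hT3.trans hT7P)
  · refine ceil_sub_one_le_floor (by positivity) ?_
    rw [div_le_iff₀ (by positivity)]
    calc bigP D = bigP D * 1 := (mul_one _).symm
      _ ≤ bigP D * bigT D ^ 7 := mul_le_mul_of_nonneg_left (one_le_pow₀ hT1) hP0.le

/-! ## B. (15.2) sharpened: `b(n) = 0` for `n ≥ PT⁻⁷`; `B`, `N`, `K`, the `E₁`-polynomial as polynomials in `ψ` -/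

/-- **(15.2), sharpened support: `b(n) = 0` for `n ≥ PT⁻⁷`** (`𝓛 ≥ 4`): by the tree's
`Typed.Section16ALeaves.bcoef_eq_zero_of_le` (`b(m) = 0` for `m ≥ P^{1/2}max(P₂,P₃)`) and
`P^{1/2}max(P₂,P₃) ≤ max(PT⁻¹⁰, P^{0.998}) ≤ PT⁻⁷` (`T⁷ ≤ P^{0.002}`). [cite: Zhang2022LandauSiegel, §15 (15.2) p.79] -/
theorem bcoef_eq_zero_of_le_T7 {D : ℕ} (hL : 4 ≤ ell D) {n : ℕ} (hn : bigP D / bigT D ^ 7 ≤ n) :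
    bcoef D n = 0 := by
  obtain ⟨hT5, hT7, -, -⟩ := sizes_of_four_le_ell hL
  have hP0 : 0 < bigP D := Real.exp_pos _
  have hT0 : 0 < bigT D := by linarith
  have hT1 : 1 ≤ bigT D := by linarith
  -- `P^{1/2} · max(P₂, P₃) ≤ P / T⁷`
  have hkey : bigP D ^ (1 / 2 : ℝ) * max (Skeleton.P2 D) (P3 D) ≤ bigP D / bigT D ^ 7 := by
    rw [le_div_iff₀ (pow_pos hT0 7)]
    have hsqrt : bigP D ^ (1 / 2 : ℝ) * bigP D ^ (1 / 2 : ℝ) = bigP D := by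
      rw [← Real.rpow_add hP0]; norm_num
    have hPh : 0 ≤ bigP D ^ (1 / 2 : ℝ) := Real.rpow_nonneg hP0.le _
    rcases le_total (P3 D) (Skeleton.P2 D) with h32 | h23
    · rw [max_eq_left h32, Skeleton.P2, show (0.5 : ℝ) = 1 / 2 by norm_num]
      have hT3 : bigT D ^ 7 ≤ bigT D ^ 10 := pow_le_pow_right₀ hT1 (by norm_num)
      have hT10 : 0 < bigT D ^ 10 := pow_pos hT0 10
      calc bigP D ^ (1 / 2 : ℝ) * (bigP D ^ (1 / 2 : ℝ) / bigT D ^ 10) * bigT D ^ 7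
          = (bigP D ^ (1 / 2 : ℝ) * bigP D ^ (1 / 2 : ℝ)) * (bigT D ^ 7 / bigT D ^ 10) := by ring
        _ ≤ (bigP D ^ (1 / 2 : ℝ) * bigP D ^ (1 / 2 : ℝ)) * 1 :=
            mul_le_mul_of_nonneg_left ((div_le_one hT10).mpr hT3) (mul_nonneg hPh hPh)
        _ = bigP D := by rw [mul_one, hsqrt]
    · rw [max_eq_right h23, P3]
      calc bigP D ^ (1 / 2 : ℝ) * bigP D ^ (0.498 : ℝ) * bigT D ^ 7
          ≤ bigP D ^ (1 / 2 : ℝ) * bigP D ^ (0.498 : ℝ) * bigP D ^ (0.002 : ℝ) :=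
            mul_le_mul_of_nonneg_left hT7 (mul_nonneg hPh (Real.rpow_nonneg hP0.le _))
        _ = bigP D := by
            rw [← Real.rpow_add hP0, ← Real.rpow_add hP0]; norm_num
  exact Typed.Section16ALeaves.bcoef_eq_zero_of_le (hkey.trans hn)

variable {D : ℕ}

/-- `ψ(mn) = ψ(m)ψ(n)` on natural numbers, and `ψ(0) = 0`, for `ψ (mod p) ∈ Ψ` (complete
multiplicativity of Dirichlet characters). [cite: Zhang2022LandauSiegel, §2 p.4] -/
theorem psi_natCast_mul (x : Chr D) :
    (∀ m n : ℕ, x.ψ ((m * n : ℕ) : ZMod x.p) = x.ψ (m : ZMod x.p) * x.ψ (n : ZMod x.p)) ∧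
      x.ψ (0 : ZMod x.p) = 0 := by
  refine ⟨fun m n => by rw [Nat.cast_mul, map_mul], ?_⟩
  haveI : Fact (1 < x.p) := ⟨x.prime.one_lt⟩
  exact MulChar.map_zero _

/-- `n^{−(s+β)} = n^{−β}·n^{−s}` for `n ≥ 1` (the shifts `β_j` of (2.13) absorbed into the
coefficients). [cite: Zhang2022LandauSiegel, §2 (2.13)] -/
theorem natCast_cpow_neg_add {n : ℕ} (hn : n ≠ 0) (s β : ℂ) :
    (n : ℂ) ^ (-(s + β)) = (n : ℂ) ^ (-β) * (n : ℂ) ^ (-s) := by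
  rw [show -(s + β) = -β + -s by ring, Complex.cpow_add _ _ (Nat.cast_ne_zero.mpr hn)]

/-- **(15.1) with the sharpened support**: for `𝓛 ≥ 4` and `ψ ∈ Ψ`,
`B(s,ψ) = Σ_{1≤n<⌈PT⁻⁷⌉} (b(n)χ(n))·ψ(n)n^{−s}`. [cite: Zhang2022LandauSiegel, §15 (15.1)–(15.2) p.79] -/
theorem Bpoly_eq_dirPoly [NeZero D] (χ : DirichletCharacter ℂ D) (hL : 4 ≤ ell D) (x : Chr D) (s : ℂ) :
    Bpoly χ x s = ∑ n ∈ Ico 1 ⌈bigP D / bigT D ^ 7⌉₊,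
      (bcoef D n * χ (n : ZMod D)) * x.ψ (n : ZMod x.p) * (n : ℂ) ^ (-s) := by
  rw [Bpoly_eq_tsum_bcoef]
  have hsum : ∑' n : ℕ, bcoef D n * pc χ x n * (n : ℂ) ^ (-s) =
      ∑ n ∈ Finset.range ⌈bigP D / bigT D ^ 7⌉₊, bcoef D n * pc χ x n * (n : ℂ) ^ (-s) := by
    refine tsum_eq_sum fun n hn => ?_
    rw [Finset.mem_range, not_lt] at hn
    rw [bcoef_eq_zero_of_le_T7 hL (le_trans (Nat.le_ceil _) (by exact_mod_cast hn))]
    simp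
  rw [hsum]
  rcases Nat.eq_zero_or_pos ⌈bigP D / bigT D ^ 7⌉₊ with h0 | hpos
  · rw [h0]; simp
  · rw [Finset.range_eq_Ico, Finset.sum_eq_sum_Ico_succ_bot hpos]
    have : pc χ x 0 = 0 := by
      rw [pc, Nat.cast_zero, (psi_natCast_mul x).2, zero_mul]
    rw [this, mul_zero, zero_mul, zero_add]
    refine Finset.sum_congr rfl fun n _ => ?_
    rw [pc]; ring

/-- `N(s+β,ψ) = Σ_{1≤n<⌈2T²⌉} (g*(T²/n)n^{−β})·ψ(n)n^{−s}`. [cite: Zhang2022LandauSiegel, §6 Lemma 6.1 p.30] -/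
theorem Nchar_shift_eq_dirPoly (x : Chr D) (s β : ℂ) :
    Nchar D (psiFn x) (s + β) = ∑ n ∈ Ico 1 ⌈2 * bigT D ^ 2⌉₊,
      ((gstar D (bigT D ^ 2 / n) : ℂ) * (n : ℂ) ^ (-β)) * x.ψ (n : ZMod x.p) * (n : ℂ) ^ (-s) := by
  rw [Nchar]
  refine Finset.sum_congr rfl fun n hn => ?_
  have hn0 : n ≠ 0 := by have := (Finset.mem_Ico.mp hn).1; omega
  rw [psiFn, natCast_cpow_neg_add hn0]
  ring

/-- `K(s+β,ψ) = Σ_{1≤n<⌈2P₄⌉} (g*(P₄/n)n^{−β})·ψ(n)n^{−s}`. [cite: Zhang2022LandauSiegel, §6 Lemma 6.1 p.30] -/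
theorem Kchar_shift_eq_dirPoly (x : Chr D) (s β : ℂ) :
    Kchar D (psiFn x) (s + β) = ∑ n ∈ Ico 1 ⌈2 * P4 D⌉₊,
      ((gstar D (P4 D / n) : ℂ) * (n : ℂ) ^ (-β)) * x.ψ (n : ZMod x.p) * (n : ℂ) ^ (-s) := by
  rw [Kchar]
  refine Finset.sum_congr rfl fun n hn => ?_
  have hn0 : n ≠ 0 := by have := (Finset.mem_Ico.mp hn).1; omega
  rw [psiFn, natCast_cpow_neg_add hn0]
  ring

/-- The `E₁`-polynomial: `Σ_{1≤n<⌈T³⌉} ψ(n)n^{−(s+β)} = Σ (1·n^{−β})·ψ(n)n^{−s}`.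
[cite: Zhang2022LandauSiegel, §6 Lemma 6.1 p.30] -/
theorem E1poly_shift_eq_dirPoly (x : Chr D) (s β : ℂ) :
    ∑ n ∈ Ico 1 ⌈bigT D ^ 3⌉₊, x.ψ (n : ZMod x.p) * (n : ℂ) ^ (-(s + β)) =
      ∑ n ∈ Ico 1 ⌈bigT D ^ 3⌉₊,
        ((1 : ℂ) * (n : ℂ) ^ (-β)) * x.ψ (n : ZMod x.p) * (n : ℂ) ^ (-s) := by
  refine Finset.sum_congr rfl fun n hn => ?_
  have hn0 : n ≠ 0 := by have := (Finset.mem_Ico.mp hn).1; omega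
  rw [natCast_cpow_neg_add hn0]
  ring

end Literature.NumberTheory.LFunctions.Zhang2022.Typed.Section13
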